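import Summits.QuantumFields.GaugeBoot.DiagonalRPTorusThreeByThreeMoments
import Summits.QuantumFields.GaugeBoot.DiagonalRPTorusTwoGaugeInvariantMaster
import HarnessLib

/-!
# On the `3 × 3` torus the gauge-invariant diagonal RP FAILS for small negative coupling — the last
`d = 2` cell (gauge-boot, L3 — the last `d = 2` cell `L = 3`, `β < 0`, 3/3)

HONEST FRAMING (cell `pub-gaugeboot`, page 1 of every file): the venture produces certified bounds
on lattice expectations at stated coupling, gauge group, dimension and torus size; NOT a mass gap,
NOT a continuum limit, NOT a string tension; NOT Yang–Mills-summit-bearing (barriers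
`FixedCouplingUltralocality`, `PerturbativeInvisibility`). A small NEGATIVE structural result about
which positivity constraints a two-dimensional TORUS certificate may use; no two-dimensional
certificate with a diagonal block exists or is planned; nothing at `β ≥ 0` changes.

## Content

The tree decides the GAUGE-INVARIANT closed-half diagonal reflection positivity
`GaugeInvariantDiagonalRP ρ β i j` on `(ℤ/L)²` for every `L ≥ 2`, every real `β` and every
continuous `ρ` with scalar commutant and `ρ ≢ 1`, EXCEPT the single cell `L = 3`, `β < 0`
(`DiagonalRPTorusTwoGaugeInvariantMaster`: `↔ (Even L ∧ 4 ≤ L) ∨ (Odd L ∧ 0 ≤ β)` for `L ≠ 3`;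
the odd-torus negative `DiagonalRPTorusOddGaugeInvariantNegative` needs `L ≥ 5` because its far
layer must not touch the mirror plaquettes). Here, by a different and ELEMENTARY mechanism:

* ★★ `wilsonExpectation_stairWitness_three_eq` — on `(ℤ/3)²` the RP form of the gauge-invariant
  staircase witness `F = tr ρ(staircase loop along the mirror)` (`stairWitness`; the closed half has
  no interior plaquette) is `⟨(ΘF)‾F⟩_{Λ,β} = K_β · I(β)` with `K_β > 0` and
  `I(β) = ∫ Φ₀(U) e^{β R(U)} dπ`, `Φ₀ = tr ρ(stairC 3) conj tr ρ(stairD 3)`, `R = Σ_y Re tr ρ(U_y)`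
  (all nine plaquettes), `π` product Haar.
* ★★ `norm_rpI_sub_cube_le` — THE CUBIC TAYLOR JET: `‖I(β) - (c/6) β³‖ ≤ C |β|⁴` for `|β| ≤ 1`,
  where `c > 0` is the third plaquette moment of `DiagonalRPTorusThreeByThreeMoments` (orders
  `0, 1, 2` vanish by lonely mirror links and the pigeonhole; order `3` is `6 · κ³ ∫|tr ρ(stairC 3)|²`
  up to multiplicity; Mathlib's `Complex.norm_exp_sub_sum_le_norm_mul_exp` bounds the remainder).
* ★★★ **`not_gaugeInvariantDiagonalRP_three_of_neg_small`** — `G` compact metrisable, `ρ` continuous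
  with scalar commutant and `ρ ≢ 1` (`SU(N)`, `U(N)`, `U(1)`, …), `i ≠ j`: there is `β₀ > 0` with
  `¬ GaugeInvariantDiagonalRP ρ β i j` on `(ℤ/3)²` for every `-β₀ < β < 0`.
* ★★★ **`gaugeInvariantDiagonalRP_three_iff_near_zero`** — with the tree's positive side
  (`gaugeInvariantDiagonalRP_two_odd`, all `β ≥ 0`): `GaugeInvariantDiagonalRP ρ β i j ↔ 0 ≤ β` for
  every `β > -β₀` on `(ℤ/3)²` — the SIGN CHANGE AT `β = 0` of every odd torus persists at `L = 3`;
  `_suN` (`N ≥ 2`), `_uN` (`N ≥ 1`).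
* ★★★ **`gaugeInvariantDiagonalRP_two_iff_allL`** (`_suN`, `N ≥ 2`; `_uN`, `N ≥ 1`) — THE `d = 2`
  TABLE WITH NO EXCEPTIONAL SIZE: for every `L ≥ 2` there is `β₀ > 0` (any value when `L ≠ 3`) with
  `GaugeInvariantDiagonalRP ρ β i j ↔ (Even L ∧ 4 ≤ L) ∨ (Odd L ∧ 0 ≤ β)` for all `β > -β₀`.

So the `d = 2` gauge-invariant diagonal-RP table has no exceptional size: for `L = 3` as for every
odd `L ≥ 5` the constraint is available exactly down to `β = 0` (here: in a neighbourhood of `0`;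
whether it fails for ALL `β < 0` at `L = 3` is left open — for `U(1)` the kernel
`Σ_l I_l(β)³ I_{1-l}(β)⁶` is numerically negative on `[-4, 0)`). Not in print as far as the cell's
searches go. Elementary.
-/

open MeasureTheory Complex Finset Function
open scoped ComplexOrder ENNReal

namespace Summit.QuantumFields.GaugeBoot

open Literature.MathematicalPhysics.QuantumFieldTheory
open Literature.MathematicalPhysics.QuantumLattice (fundamentalRep unitaryFundamentalRep
  continuous_fundamentalRep continuous_unitaryFundamentalRep)
open Literature.RepresentationTheory.CompactGroups

noncomputable section

namespace DiagRPTwo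

/-! ## The `3 × 3` torus: the witness and the RP integrand -/

section Three

variable {N : ℕ} {G : Type*} [Group G] [TopologicalSpace G] [IsTopologicalGroup G]
  [CompactSpace G] (ρ : G →* Matrix (Fin N) (Fin N) ℂ) {i j : Fin 2}

omit [TopologicalSpace G] [IsTopologicalGroup G] [CompactSpace G] in
/-- On `(ℤ/3)²` the closed diagonal half has no interior plaquette. -/
theorem Sp_three_eq_empty (i j : Fin 2) : Sp (L := 3) i j = ∅ := by
  ext y
  simp only [mem_Sp, Finset.notMem_empty, iff_false, not_and, not_lt]
  intro h
  omega

omit [TopologicalSpace G] [IsTopologicalGroup G] [CompactSpace G] in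
/-- On `(ℤ/3)²` the staircase witness is the bare character of the staircase loop. -/
theorem stairWitness_three (β : ℝ) (U : GaugeConfig 2 3 G) :
    stairWitness ρ i j β U = (ρ (stairC i j 3 U)).trace := by
  rw [stairWitness, Sp_three_eq_empty, Finset.sum_empty, mul_zero, neg_zero, Real.exp_zero,
    Complex.ofReal_one, mul_one]

/-- ★ **The RP integrand on `(ℤ/3)²`**:
`e^{-βS(U)} conj F(ΘU) F(U) = e^{-9Nβ} · Φ₀(U) e^{β R(U)}`. -/
theorem rpIntegrand_three_eq (hij : i ≠ j) (hρ : Continuous ρ) (β : ℝ) (U : GaugeConfig 2 3 G) :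
    (Real.exp (-β * wilsonAction ρ U) : ℂ) *
        ((starRingEnd ℂ) (stairWitness ρ i j β (configDiagSwap i j U)) * stairWitness ρ i j β U) =
      (Real.exp (-(β * (N * Fintype.card (Plaquette 2 3)))) : ℂ) *
        ((ρ (stairC i j 3 U)).trace * (starRingEnd ℂ) ((ρ (stairD i j 3 U)).trace) *
          (Real.exp (β * ∑ y, rr ρ i j U y) : ℂ)) := by
  rw [stairWitness_three, stairWitness_three, stairC_configDiagSwap, wilsonAction_eq_sum_rr ρ hρ hij,
    show -β * (↑N * ↑(Fintype.card (Plaquette 2 3)) - ∑ y, rr ρ i j U y) =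
      -(β * (↑N * ↑(Fintype.card (Plaquette 2 3)))) + β * ∑ y, rr ρ i j U y by ring, Real.exp_add]
  push_cast
  ring

variable [MeasurableSpace G] [BorelSpace G] [SecondCountableTopology G]

omit [SecondCountableTopology G] in
/-- ★★ **The RP expectation of the staircase witness on `(ℤ/3)²`**:
`⟨(ΘF)‾F⟩_{Λ,β} = K_β · ∫ Φ₀ e^{βR} dπ` with `K_β > 0`. -/
theorem wilsonExpectation_stairWitness_three_eq (hij : i ≠ j) (hρ : Continuous ρ) (β : ℝ) :
    ∃ K : ℝ, 0 < K ∧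
      wilsonExpectation (d := 2) (L := 3) ρ β (fun U : GaugeConfig 2 3 G =>
        (starRingEnd ℂ) (stairWitness ρ i j β (configDiagSwap i j U)) * stairWitness ρ i j β U) =
        (K : ℂ) * ∫ U, (ρ (stairC i j 3 U)).trace * (starRingEnd ℂ) ((ρ (stairD i j 3 U)).trace) *
          (Real.exp (β * ∑ y, rr ρ i j U y) : ℂ) ∂(linkMeasure 3 G) := by
  obtain ⟨hZ0, hZT⟩ := partitionFunction_ne_zero_ne_top (d := 2) (L := 3) ρ hρ β
  have hdens : Measurable fun U : GaugeConfig 2 3 G =>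
      ENNReal.ofReal (Real.exp (-β * wilsonAction ρ U)) :=
    ENNReal.measurable_ofReal.comp ((WilsonRP.measurable_wilsonAction ρ hρ).const_mul (-β)).exp
  refine ⟨((partitionFunction (d := 2) (L := 3) ρ β)⁻¹).toReal *
      Real.exp (-(β * (N * Fintype.card (Plaquette 2 3)))),
    mul_pos (ENNReal.toReal_pos (ENNReal.inv_ne_zero.2 hZT) (ENNReal.inv_ne_top.2 hZ0))
      (Real.exp_pos _), ?_⟩
  unfold wilsonExpectation wilsonMeasure
  rw [integral_smul_measure]
  unfold wilsonWeight
  rw [integral_withDensity_eq_integral_toReal_smul hdens (ae_of_all _ fun _ => ENNReal.ofReal_lt_top)]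
  simp_rw [ENNReal.toReal_ofReal (Real.exp_nonneg _), Complex.real_smul]
  simp_rw [rpIntegrand_three_eq ρ hij hρ β]
  rw [integral_const_mul]
  change _ * (_ * ∫ U, _ ∂(linkMeasure 3 G)) = _
  push_cast
  ring

/-! ## The cubic Taylor jet of `I(β) = ∫ Φ₀ e^{βR} dπ` -/

omit [MeasurableSpace G] [BorelSpace G] [SecondCountableTopology G] in
/-- `|R(U)| ≤ 9N` (as `#sites · N`). -/
theorem abs_sum_rr_univ_le (hρ : Continuous ρ) (U : GaugeConfig 2 3 G) :
    |∑ y, rr ρ i j U y| ≤ (Finset.univ : Finset (Site 2 3)).card * N :=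
  abs_sum_rr_le ρ hρ i j _ U

/-- ★★ **THE CUBIC TAYLOR JET**: with the third moment `c > 0` of
`DiagonalRPTorusThreeByThreeMoments.integral_pair_mul_cube`, for every `|β| ≤ 1`,
`‖I(β) - (c/6) β³‖ ≤ C |β|⁴` (`C = C_Φ B⁴ e^B`, `B = 9N`). -/
theorem norm_rpI_sub_cube_le (hij : i ≠ j) (hρ : Continuous ρ)
    (hirr : TwistedSlab.HasScalarCommutant ρ) (hρ1 : ∃ g, ρ g ≠ 1) :
    ∃ c C : ℝ, 0 < c ∧ 0 ≤ C ∧ ∀ β : ℝ, |β| ≤ 1 →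
      ‖(∫ U, (ρ (stairC i j 3 U)).trace * (starRingEnd ℂ) ((ρ (stairD i j 3 U)).trace) *
          (Real.exp (β * ∑ y, rr ρ i j U y) : ℂ) ∂(linkMeasure 3 G)) - ((c / 6 * β ^ 3 : ℝ) : ℂ)‖ ≤
        C * |β| ^ 4 := by
  obtain ⟨c, hc, hm3⟩ := integral_pair_mul_cube ρ hij hρ hirr hρ1
  obtain ⟨CΦ, hCΦ0, hCΦ⟩ := exists_norm_stairPair_le (L := 3) (i := i) (j := j) ρ hρ
  set B : ℝ := ((Finset.univ : Finset (Site 2 3)).card : ℝ) * N with hB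
  have hB0 : 0 ≤ B := by positivity
  refine ⟨c, CΦ * (B ^ 4 * Real.exp B), hc, by positivity, fun β hβ => ?_⟩
  -- abbreviations
  set Φ : GaugeConfig 2 3 G → ℂ := fun U =>
    (ρ (stairC i j 3 U)).trace * (starRingEnd ℂ) ((ρ (stairD i j 3 U)).trace) with hΦ
  set R : GaugeConfig 2 3 G → ℝ := fun U => ∑ y, rr ρ i j U y with hR
  have hΦc : Continuous Φ := continuous_stairPair ρ hρ
  have hRc : Continuous R := continuous_finsetSum _ fun y _ => continuous_rr' ρ hρ y
  have hRB : ∀ U, |R U| ≤ B := fun U => abs_sum_rr_univ_le ρ hρ U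
  -- the Taylor polynomial and the remainder, pointwise
  set T : GaugeConfig 2 3 G → ℂ := fun U =>
    ∑ m ∈ Finset.range 4, ((β : ℂ) * (R U : ℂ)) ^ m / (m.factorial : ℂ) with hT
  have hexp : ∀ U, (Real.exp (β * R U) : ℂ) = Complex.exp ((β : ℂ) * (R U : ℂ)) := fun U => by
    rw [Complex.ofReal_exp]; push_cast; rfl
  have hrem : ∀ U, ‖Φ U * (Complex.exp ((β : ℂ) * (R U : ℂ)) - T U)‖ ≤ CΦ * ((|β| * B) ^ 4 * Real.exp B) := by
    intro U
    rw [norm_mul]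
    refine mul_le_mul (hCΦ U) ?_ (norm_nonneg _) hCΦ0
    have h := Complex.norm_exp_sub_sum_le_norm_mul_exp ((β : ℂ) * (R U : ℂ)) 4
    have hz : ‖(β : ℂ) * (R U : ℂ)‖ = |β| * |R U| := by
      rw [norm_mul, Complex.norm_real, Complex.norm_real, Real.norm_eq_abs, Real.norm_eq_abs]
    rw [hz] at h
    refine h.trans (mul_le_mul (pow_le_pow_left₀ (by positivity)
      (mul_le_mul_of_nonneg_left (hRB U) (abs_nonneg β)) 4) (Real.exp_le_exp.2 ?_) (Real.exp_pos _).le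
      (by positivity))
    calc |β| * |R U| ≤ 1 * B := mul_le_mul hβ (hRB U) (abs_nonneg _) zero_le_one
      _ = B := one_mul B
  -- integrability
  have hint : ∀ f : GaugeConfig 2 3 G → ℂ, Continuous f → Integrable f (linkMeasure 3 G) := fun f hf =>
    hf.integrable_of_hasCompactSupport (HasCompactSupport.of_compactSpace _)
  have hTc : Continuous T := by
    refine continuous_finsetSum _ fun m _ => ?_
    exact ((continuous_const.mul (Complex.continuous_ofReal.comp hRc)).pow m).div_const _
  have hEc : Continuous fun U => Complex.exp ((β : ℂ) * (R U : ℂ)) :=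
    Complex.continuous_exp.comp (continuous_const.mul (Complex.continuous_ofReal.comp hRc))
  -- the polynomial part integrates to `(c/6) β³`
  have hpoly : ∫ U, Φ U * T U ∂(linkMeasure 3 G) = ((c / 6 * β ^ 3 : ℝ) : ℂ) := by
    have h1 : ∀ U, Φ U * T U = ∑ m ∈ Finset.range 4,
        ((β : ℂ) ^ m / (m.factorial : ℂ)) * (Φ U * (R U : ℂ) ^ m) := fun U => by
      simp only [hT, Finset.mul_sum, mul_pow]
      refine Finset.sum_congr rfl fun m _ => ?_
      ring
    simp_rw [h1]
    rw [integral_finsetSum _ fun m _ =>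
      (hint (fun U => ((β : ℂ) ^ m / (m.factorial : ℂ)) * (Φ U * (R U : ℂ) ^ m))
        (continuous_const.mul (hΦc.mul ((Complex.continuous_ofReal.comp hRc).pow m))))]
    simp_rw [integral_const_mul]
    simp only [Finset.sum_range_succ, Finset.sum_range_zero, zero_add, hΦ, hR]
    rw [integral_pair_mul_pow_eq_zero ρ hij hρ hirr hρ1 (show 0 < 3 by norm_num),
      integral_pair_mul_pow_eq_zero ρ hij hρ hirr hρ1 (show 1 < 3 by norm_num),
      integral_pair_mul_pow_eq_zero ρ hij hρ hirr hρ1 (show 2 < 3 by norm_num), hm3]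
    simp only [mul_zero, zero_add, Nat.factorial]
    push_cast
    ring
  -- split the integral
  have hsplit : (∫ U, Φ U * (Real.exp (β * R U) : ℂ) ∂(linkMeasure 3 G)) =
      (∫ U, Φ U * (Complex.exp ((β : ℂ) * (R U : ℂ)) - T U) ∂(linkMeasure 3 G)) +
        ∫ U, Φ U * T U ∂(linkMeasure 3 G) := by
    rw [← integral_add
      (hint (fun U => Φ U * (Complex.exp ((β : ℂ) * (R U : ℂ)) - T U)) (hΦc.mul (hEc.sub hTc)))
      (hint (fun U => Φ U * T U) (hΦc.mul hTc))]
    refine integral_congr_ae (ae_of_all _ fun U => ?_)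
    simp only [hexp]
    ring
  show ‖(∫ U, Φ U * (Real.exp (β * R U) : ℂ) ∂(linkMeasure 3 G)) - ((c / 6 * β ^ 3 : ℝ) : ℂ)‖ ≤
    CΦ * (B ^ 4 * Real.exp B) * |β| ^ 4
  rw [hsplit, hpoly, add_sub_cancel_right]
  refine (norm_integral_le_of_norm_le_const (ae_of_all _ hrem)).trans ?_
  rw [probReal_univ, mul_one, mul_pow]
  exact le_of_eq (by ring)

/-! ## The sign for small negative `β` and the main theorem -/

omit [MeasurableSpace G] [BorelSpace G] [SecondCountableTopology G] [TopologicalSpace G]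
  [IsTopologicalGroup G] [CompactSpace G] in
/-- Elementary sign lemma: `|f(β) - a β³| ≤ C β⁴` on `|β| ≤ 1` with `a > 0` forces `f(β) < 0` for
`-min(1, a/(2(C+1))) < β < 0`. -/
theorem neg_of_cubic_jet {f : ℝ → ℝ} {a C : ℝ} (ha : 0 < a) (hC : 0 ≤ C)
    (h : ∀ β : ℝ, |β| ≤ 1 → |f β - a * β ^ 3| ≤ C * |β| ^ 4) {β : ℝ}
    (hβ0 : β < 0) (hβ1 : -min 1 (a / (2 * (C + 1))) < β) : f β < 0 := by
  have hmin1 : min 1 (a / (2 * (C + 1))) ≤ 1 := min_le_left _ _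
  have hmin2 : min 1 (a / (2 * (C + 1))) ≤ a / (2 * (C + 1)) := min_le_right _ _
  have habs : |β| = -β := abs_of_neg hβ0
  have hβabs : |β| ≤ 1 := by rw [habs]; linarith
  have h1 := (abs_le.1 (h β hβabs)).2
  -- `f β ≤ a β³ + C β⁴ = |β|³ (-a + C |β|) ≤ |β|³ (-a + a/2) < 0`
  have hb3 : β ^ 3 = -|β| ^ 3 := by rw [habs]; ring
  have hb4 : |β| ^ 4 = |β| ^ 3 * |β| := by ring
  have hpos : 0 < |β| ^ 3 := pow_pos (abs_pos.2 hβ0.ne) 3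
  have hCb : C * |β| ≤ a / 2 := by
    have hlt : |β| < a / (2 * (C + 1)) := by rw [habs]; linarith
    calc C * |β| ≤ (C + 1) * (a / (2 * (C + 1))) :=
          mul_le_mul (by linarith) hlt.le (abs_nonneg _) (by linarith)
      _ = a / 2 := by field_simp
  nlinarith [h1, hb3, hb4, hpos, hCb]

/-- ★★★ **ON THE `3 × 3` TORUS THE GAUGE-INVARIANT DIAGONAL RP FAILS FOR SMALL NEGATIVE COUPLING.**
`G` compact metrisable, `ρ : G → M_N(ℂ)` continuous with scalar commutant and `ρ ≢ 1`, `i ≠ j`: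
there is `β₀ > 0` such that for every `-β₀ < β < 0` the gauge-invariant closed-half observable
`stairWitness` (the character of the staircase loop along the mirror) has `⟨(ΘF)‾F⟩_{Λ,β} < 0` on
`(ℤ/3)²`, so `¬ GaugeInvariantDiagonalRP ρ β i j`. -/
theorem not_gaugeInvariantDiagonalRP_three_of_neg_small (hij : i ≠ j) (hρ : Continuous ρ)
    (hirr : TwistedSlab.HasScalarCommutant ρ) (hρ1 : ∃ g, ρ g ≠ 1) :
    ∃ β₀ : ℝ, 0 < β₀ ∧ ∀ β : ℝ, -β₀ < β → β < 0 →
      ¬ GaugeInvariantDiagonalRP (d := 2) (L := 3) ρ β i j := by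
  obtain ⟨c, C, hc, hC, hjet⟩ := norm_rpI_sub_cube_le (G := G) ρ hij hρ hirr hρ1
  refine ⟨min 1 (c / 6 / (2 * (C + 1))), lt_min one_pos (by positivity), fun β hβ1 hβ0 hRP => ?_⟩
  -- the real part of `I(β)` is negative
  set I : ℝ → ℂ := fun β => ∫ U, (ρ (stairC i j 3 U)).trace * (starRingEnd ℂ) ((ρ (stairD i j 3 U)).trace) *
    (Real.exp (β * ∑ y, rr ρ i j U y) : ℂ) ∂(linkMeasure 3 G) with hI
  have hre : ∀ β : ℝ, |β| ≤ 1 → |(I β).re - c / 6 * β ^ 3| ≤ C * |β| ^ 4 := by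
    intro β hβ
    have h := hjet β hβ
    have h2 : (I β).re - c / 6 * β ^ 3 = (I β - ((c / 6 * β ^ 3 : ℝ) : ℂ)).re := by
      rw [Complex.sub_re, Complex.ofReal_re]
    rw [h2]
    exact (Complex.abs_re_le_norm _).trans h
  have hneg : (I β).re < 0 :=
    neg_of_cubic_jet (f := fun β => (I β).re) (by positivity) hC hre hβ0 hβ1
  -- the RP form of the witness is `K · I(β)` with `K > 0`
  obtain ⟨K, hK, hE⟩ := wilsonExpectation_stairWitness_three_eq (G := G) (i := i) (j := j) ρ hij hρ β
  have h := hRP (stairWitness ρ i j β) (measurable_stairWitness ρ hρ β)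
    (exists_norm_stairWitness_le ρ hρ β) (isDiagonalHalfObservable_stairWitness ρ le_rfl hij β)
    (isGaugeInvariant_stairWitness ρ hij β)
  rw [hE] at h
  have h3 := (Complex.nonneg_iff.1 h).1
  rw [Complex.re_ofReal_mul] at h3
  exact absurd h3 (not_le.2 (mul_neg_of_pos_of_neg hK hneg))

/-- ★★★ **The sign change at `β = 0` persists at `L = 3`**: `ρ` continuous with scalar commutant
and `ρ ≢ 1`; there is `β₀ > 0` such that for every `β > -β₀`,
`GaugeInvariantDiagonalRP ρ β i j ↔ 0 ≤ β` on `(ℤ/3)²` (positive side: the tree's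
`gaugeInvariantDiagonalRP_two_odd`, every `β ≥ 0`). -/
theorem gaugeInvariantDiagonalRP_three_iff_near_zero (hij : i ≠ j) (hρ : Continuous ρ)
    (hirr : TwistedSlab.HasScalarCommutant ρ) (hρ1 : ∃ g, ρ g ≠ 1) :
    ∃ β₀ : ℝ, 0 < β₀ ∧ ∀ β : ℝ, -β₀ < β →
      (GaugeInvariantDiagonalRP (d := 2) (L := 3) ρ β i j ↔ 0 ≤ β) := by
  obtain ⟨β₀, hβ₀, h⟩ := not_gaugeInvariantDiagonalRP_three_of_neg_small (G := G) ρ hij hρ hirr hρ1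
  refine ⟨β₀, hβ₀, fun β hβ => ⟨fun hRP => ?_, fun hb => ?_⟩⟩
  · by_contra hb
    exact h β hβ (not_le.1 hb) hRP
  · exact gaugeInvariantDiagonalRP_two_odd ρ (by decide) le_rfl hρ hb hij

/-- The full closed-half statement fails there as well (it implies the gauge-invariant one). -/
theorem not_diagonalReflectionPositive_three_of_neg_small (hij : i ≠ j) (hρ : Continuous ρ)
    (hirr : TwistedSlab.HasScalarCommutant ρ) (hρ1 : ∃ g, ρ g ≠ 1) :
    ∃ β₀ : ℝ, 0 < β₀ ∧ ∀ β : ℝ, -β₀ < β → β < 0 →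
      ¬ DiagonalReflectionPositive (d := 2) (L := 3) ρ β i j := by
  obtain ⟨β₀, hβ₀, h⟩ := not_gaugeInvariantDiagonalRP_three_of_neg_small (G := G) ρ hij hρ hirr hρ1
  exact ⟨β₀, hβ₀, fun β hβ hβ0 hRP => h β hβ hβ0 hRP.gaugeInvariantDiagonalRP⟩

/-- ★★★ **`SU(N)`, `N ≥ 2`, on `(ℤ/3)²`**: near `β = 0` the gauge-invariant closed-half diagonal RP
holds IFF `0 ≤ β`. -/
theorem gaugeInvariantDiagonalRP_three_iff_near_zero_suN {N : ℕ} (hN : 2 ≤ N) {i j : Fin 2}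
    (hij : i ≠ j) :
    ∃ β₀ : ℝ, 0 < β₀ ∧ ∀ β : ℝ, -β₀ < β →
      (GaugeInvariantDiagonalRP (d := 2) (L := 3) (fundamentalRep (Fin N)) β i j ↔ 0 ≤ β) := by
  haveI : SecondCountableTopology (Matrix (Fin N) (Fin N) ℂ) :=
    inferInstanceAs (SecondCountableTopology (Fin N → Fin N → ℂ))
  haveI : SecondCountableTopology (Matrix.specialUnitaryGroup (Fin N) ℂ) :=
    Topology.IsEmbedding.subtypeVal.secondCountableTopology
  exact gaugeInvariantDiagonalRP_three_iff_near_zero (fundamentalRep (Fin N)) hij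
    (continuous_fundamentalRep (Fin N)) TiltedRP.hasScalarCommutant_fundamentalRep
    (TiltedRP.exists_fundamentalRep_ne_one hN)

/-- ★★★ **`U(N)`, `N ≥ 1` (so `U(1)` too), on `(ℤ/3)²**: near `β = 0` the gauge-invariant
closed-half diagonal RP holds IFF `0 ≤ β`. -/
theorem gaugeInvariantDiagonalRP_three_iff_near_zero_uN {N : ℕ} (hN : 1 ≤ N) {i j : Fin 2}
    (hij : i ≠ j) :
    ∃ β₀ : ℝ, 0 < β₀ ∧ ∀ β : ℝ, -β₀ < β →
      (GaugeInvariantDiagonalRP (d := 2) (L := 3) (unitaryFundamentalRep (Fin N) ℂ) β i j ↔ 0 ≤ β) := by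
  haveI : SecondCountableTopology (Matrix (Fin N) (Fin N) ℂ) :=
    inferInstanceAs (SecondCountableTopology (Fin N → Fin N → ℂ))
  haveI : SecondCountableTopology (Matrix.unitaryGroup (Fin N) ℂ) :=
    Topology.IsEmbedding.subtypeVal.secondCountableTopology
  exact gaugeInvariantDiagonalRP_three_iff_near_zero (unitaryFundamentalRep (Fin N) ℂ) hij
    (continuous_unitaryFundamentalRep (n := Fin N) (𝕜 := ℂ)) TiltedRP.hasScalarCommutant_unitaryFundamentalRep
    (TiltedRP.exists_unitaryFundamentalRep_ne_one hN)

end Three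

/-! ## The `d = 2` gauge-invariant table at every size -/

section AllSizes

variable {L N : ℕ} [NeZero L] {G : Type*} [Group G] [TopologicalSpace G] [IsTopologicalGroup G]
  [CompactSpace G] [T2Space G] [MeasurableSpace G] [BorelSpace G] [SecondCountableTopology G]
  (ρ : G →* Matrix (Fin N) (Fin N) ℂ) {i j : Fin 2}

/-- ★★★ **THE `d = 2` GAUGE-INVARIANT DIAGONAL-RP TABLE, NO EXCEPTIONAL SIZE**: `G` compact
metrisable (Hausdorff), `ρ` continuous with scalar commutant and `ρ ≢ 1`, `(ℤ/L)²` with `L ≥ 2`, `i ≠ j`: there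
is `β₀ > 0` such that for every `β > -β₀`,
`GaugeInvariantDiagonalRP ρ β i j ↔ (Even L ∧ 4 ≤ L) ∨ (Odd L ∧ 0 ≤ β)` — for `L ≠ 3` at EVERY real
`β` (tree, `gaugeInvariantDiagonalRP_two_iff_master`), for `L = 3` near `β = 0` (this file). -/
theorem gaugeInvariantDiagonalRP_two_iff_allL (h2 : 2 ≤ L) (hρ : Continuous ρ)
    (hirr : TwistedSlab.HasScalarCommutant ρ) (hρ1 : ∃ g, ρ g ≠ 1) (hij : i ≠ j) :
    ∃ β₀ : ℝ, 0 < β₀ ∧ ∀ β : ℝ, -β₀ < β →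
      (GaugeInvariantDiagonalRP (d := 2) (L := L) ρ β i j ↔ (Even L ∧ 4 ≤ L) ∨ (Odd L ∧ 0 ≤ β)) := by
  by_cases h3 : L = 3
  · subst h3
    obtain ⟨β₀, hβ₀, h⟩ := gaugeInvariantDiagonalRP_three_iff_near_zero (G := G) ρ hij hρ hirr hρ1
    refine ⟨β₀, hβ₀, fun β hβ => (h β hβ).trans ?_⟩
    have hE : ¬ Even 3 := by decide
    have hO : Odd 3 := by decide
    simp only [hE, hO, false_and, true_and, false_or]
  · exact ⟨1, one_pos, fun β _ => gaugeInvariantDiagonalRP_two_iff_master ρ h2 h3 hρ hirr hρ1 β hij⟩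

/-- ★★★ `SU(N)`, `N ≥ 2`, every `(ℤ/L)²` with `L ≥ 2`: the table above (near `β = 0` when `L = 3`). -/
theorem gaugeInvariantDiagonalRP_two_iff_allL_suN {L N : ℕ} [NeZero L] (h2 : 2 ≤ L) (hN : 2 ≤ N)
    {i j : Fin 2} (hij : i ≠ j) :
    ∃ β₀ : ℝ, 0 < β₀ ∧ ∀ β : ℝ, -β₀ < β →
      (GaugeInvariantDiagonalRP (d := 2) (L := L) (fundamentalRep (Fin N)) β i j ↔
        (Even L ∧ 4 ≤ L) ∨ (Odd L ∧ 0 ≤ β)) := by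
  haveI : SecondCountableTopology (Matrix (Fin N) (Fin N) ℂ) :=
    inferInstanceAs (SecondCountableTopology (Fin N → Fin N → ℂ))
  haveI : SecondCountableTopology (Matrix.specialUnitaryGroup (Fin N) ℂ) :=
    Topology.IsEmbedding.subtypeVal.secondCountableTopology
  exact gaugeInvariantDiagonalRP_two_iff_allL (fundamentalRep (Fin N)) h2
    (continuous_fundamentalRep (Fin N)) TiltedRP.hasScalarCommutant_fundamentalRep
    (TiltedRP.exists_fundamentalRep_ne_one hN) hij

/-- ★★★ `U(N)`, `N ≥ 1` (so `U(1)` too), every `(ℤ/L)²` with `L ≥ 2`: the same table. -/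
theorem gaugeInvariantDiagonalRP_two_iff_allL_uN {L N : ℕ} [NeZero L] (h2 : 2 ≤ L) (hN : 1 ≤ N)
    {i j : Fin 2} (hij : i ≠ j) :
    ∃ β₀ : ℝ, 0 < β₀ ∧ ∀ β : ℝ, -β₀ < β →
      (GaugeInvariantDiagonalRP (d := 2) (L := L) (unitaryFundamentalRep (Fin N) ℂ) β i j ↔
        (Even L ∧ 4 ≤ L) ∨ (Odd L ∧ 0 ≤ β)) := by
  haveI : SecondCountableTopology (Matrix (Fin N) (Fin N) ℂ) :=
    inferInstanceAs (SecondCountableTopology (Fin N → Fin N → ℂ))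
  haveI : SecondCountableTopology (Matrix.unitaryGroup (Fin N) ℂ) :=
    Topology.IsEmbedding.subtypeVal.secondCountableTopology
  exact gaugeInvariantDiagonalRP_two_iff_allL (unitaryFundamentalRep (Fin N) ℂ) h2
    (continuous_unitaryFundamentalRep (n := Fin N) (𝕜 := ℂ))
    TiltedRP.hasScalarCommutant_unitaryFundamentalRep (TiltedRP.exists_unitaryFundamentalRep_ne_one hN) hij

end AllSizes

end DiagRPTwo

end

end Summit.QuantumFields.GaugeBoot
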